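import Summits.ABC.IUTFork.Repair.RHSigmaBudget
import Summits.ABC.IUTFork.Repair.RHSigmaLicence
import HarnessLib

/-!
# R-H ROUND 2, Q2: BRIDGE between the two landed «S|Σ ⇒ weakened Cor. 3.12» vocabularies — the signed off-window DEFICIT budget
# (`RHSigmaBudget`, abc-iut-rh-typ-12, p467532) and the positive-part OFF-Σ REMAINDER / `StatementUpTo` (`RH.SigmaLicence`, abc-iut-rh2-q2-eq, p468453)

PROOF-ONLY file (0 definitions) of the abc-iut cell, rung LADDER-ABC:A2.RESCUE.H (typer abc-iut-rh-typ-12, round 2 Q2(15); both inputs consumed BY NAME).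
* `statementUpTo_of_licenceOn_of_offWindowDeficitLe` — bridge hypotheses ∧ `LicenceOn P Σ` ∧ «signed off-Σ deficit `D_off(Σ) ≤ B`»
  (`OffWindowDeficitLe`) ⟹ `StatementUpTo P B` (abc-iut-rh2-q2-eq's claim form of the weakened Corollary): the SIGNED budget is a socket for the
  same `ε`-threading towards «abc with a worse constant» (rh2-q2-cond).
* `offWindowDeficitLe_offRemainder` — `D_off(Σ) ≤ offRemainder P Σ` always (cell by cell `−σ = cellDeficit ≤ (cellDeficit)⁺`; off-Σ cells with
  SURPLUS are credited by the signed form and discarded by the positive part): the signed budget is the SHARPER of the two, and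
  `statementUpTo_offRemainder_of_licenceOn'` recovers rh2-q2-eq's theorem through it.
TAKES NO SIDE on [IUTchIII] Cor. 3.12 or on any author; nothing asserts abc proved or refuted; typed ≠ proved; instantiated ≠ endorsed.
[cite: Mochizuki2012, IUTchIII Cor. 3.12 p. 173–174] [cite: ScholzeStix2018, §2.2 p. 10] [claim: Mochizuki2012, status: disputed] for every IUT locution.
-/

noncomputable section

open Set

namespace Summit.ABC.IUTFork.Repair.RHSlotReach

open Thm311 Cor312 Cor312.Setting Cor312Vol Literature.IUT.LogThetaLattice Summit.ABC.IUTFork.Repair.RH.SigmaLicence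

variable {T : ThetaIndex} (S : LatticeSituation T) (P : Cor312.Setting S.toSituation) (W : Set (Fin T.lstar × T.VQ))

/-- **SIGNED-DEFICIT SOCKET FOR `StatementUpTo`**: under the bridge hypotheses, licence on the window `Σ` and `D_off(Σ) ≤ B` (signed off-window
deficit, `OffWindowDeficitLe`) give abc-iut-rh2-q2-eq's `StatementUpTo P B` («−|log(Θ)| ∈ ℝ ∧ −|log(q)| ≤ −|log(Θ)| + B»).
[claim: Mochizuki2012, status: disputed] -/
theorem statementUpTo_of_licenceOn_of_offWindowDeficitLe (HB : BridgeHyps P) (hon : LicenceOn P W) {B : ℝ}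
    (hB : OffWindowDeficitLe S P W B) : StatementUpTo P B := by
  have h := negLogQ_sub_le_negLogTheta_of_licenceOn S P W HB (fun i vQ hW => hon (i, vQ) hW) hB
  have hΘ := ObstructionSS28Window.negLogTheta_eq_negLogQ_add_avg_cellSlack S P HB.finite
  unfold StatementUpTo
  rw [hΘ] at h ⊢
  refine ⟨WithTop.coe_ne_top, ?_⟩
  rw [← WithTop.coe_add, WithTop.coe_le_coe]
  rw [WithTop.coe_le_coe] at h
  linarith

/-- **THE SIGNED DEFICIT IS AT MOST THE POSITIVE-PART REMAINDER**: `D_off(Σ) ≤ offRemainder P Σ` for every window `Σ` (bridge hypotheses, for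
the finiteness of the cell sums): cell by cell `−σ_{i+1,v_ℚ} = cellDeficit ≤ (cellDeficit)⁺`, and an off-Σ cell with surplus (`σ > 0`) LOWERS the
signed deficit while the remainder ignores it. So `OffWindowDeficitLe S P Σ (offRemainder P Σ)` holds identically. [claim: Mochizuki2012, status: disputed] -/
theorem offWindowDeficitLe_offRemainder (HB : BridgeHyps P) : OffWindowDeficitLe S P W (offRemainder P W) := by
  unfold OffWindowDeficitLe offRemainder processionNormalized
  rw [← neg_div, ← Finset.sum_neg_distrib]
  refine div_le_div_of_nonneg_right (Finset.sum_le_sum fun i _ => ?_) (Nat.cast_nonneg _)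
  -- label `i`: `Σᶠ_{off} (−σ) ≤ Σᶠ 1_{Σᶜ}·(deficit)⁺`
  show -(∑ᶠ vQ ∈ {vQ : T.VQ | (i, vQ) ∉ W},
      ((S.D P.n).logvol _ vQ (P.thetaHull (Setting.labelSucc i) vQ) - P.qLocal (Setting.labelSucc i) vQ)) ≤
    ∑ᶠ vQ : T.VQ, Wᶜ.indicator (fun t : Fin T.lstar × T.VQ => max (cellDeficit P t.1 t.2) 0) (i, vQ)
  rw [finsum_mem_def, ← finsum_neg_distrib]
  refine finsum_le_finsum' ?_ ?_ (fun vQ => ?_)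
  · -- finite support of the negated off-window slack
    show (Function.support _).Finite
    refine (ObstructionSS28Window.cellSlack_support_finite S P HB.finite i).subset fun vQ hv => ?_
    rw [Function.mem_support] at hv ⊢
    intro h0
    apply hv
    by_cases hW : vQ ∈ {vQ : T.VQ | (i, vQ) ∉ W}
    · simp only [Set.indicator_of_mem hW, h0, neg_zero]
    · simp only [Set.indicator_of_notMem hW, neg_zero]
  · exact indicator_deficit_support_finite HB W i
  · -- pointwise
    dsimp only
    by_cases hW : (i, vQ) ∈ W
    · have h1 : vQ ∉ {vQ : T.VQ | (i, vQ) ∉ W} := fun h => h hW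
      have h2 : (i, vQ) ∉ Wᶜ := fun h => h hW
      rw [Set.indicator_of_notMem h1, Set.indicator_of_notMem h2, neg_zero]
    · have h1 : vQ ∈ {vQ : T.VQ | (i, vQ) ∉ W} := hW
      have h2 : (i, vQ) ∈ Wᶜ := hW
      rw [Set.indicator_of_mem h1, Set.indicator_of_mem h2]
      show -((S.D P.n).logvol _ vQ (P.thetaHull (Setting.labelSucc i) vQ) - P.qLocal (Setting.labelSucc i) vQ) ≤
        max (cellDeficit P i vQ) 0
      unfold cellDeficit
      rw [neg_sub]
      exact le_max_left _ _

/-- **abc-iut-rh2-q2-eq's `statementUpTo_offRemainder_of_licenceOn` through the signed budget** (consistency check of the two vocabularies).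
[claim: Mochizuki2012, status: disputed] -/
theorem statementUpTo_offRemainder_of_licenceOn' (HB : BridgeHyps P) (hon : LicenceOn P W) :
    StatementUpTo P (offRemainder P W) :=
  statementUpTo_of_licenceOn_of_offWindowDeficitLe S P W HB hon (offWindowDeficitLe_offRemainder S P W HB)

end Summit.ABC.IUTFork.Repair.RHSlotReach

end
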